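import Summits.Ventures.LatticeQCDFlow.Scaling.ParallelTemperingPairCycleMoves

/-!
HONEST FRAMING: exact (Metropolis-corrected) sampling algorithms for lattice gauge theory; figures
of merit are autocorrelation/cost numbers at stated couplings and volumes; no continuum-physics
claim.

# ParallelTemperingPairCycleTag — WHERE THE TAG GOES UNDER A SWEEP OF SWAP ATTEMPTS OVER PAIRWISE DISJOINT PAIRS:
# UP FROM `j` / DOWN FROM `j+1` WITH PROBABILITY EXACTLY `r_j(x)` WHEN THE PAIR `(j, j+1)` IS IN THE LIST, NEVER TO
# A LEVEL NO LISTED PAIR REACHES (lean-2 GEN-15, ours)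

Venture-side (OURS).  Cell `lqcd-flow` (pub-lqcd), unit `pub-lqcd-lean-2-g15`, 2026-08-24.  Companion of
`Scaling/ParallelTemperingPairCycle(Moves)`: there the sweep `ptPairCycle js` over a list of pairwise disjoint
adjacent pairs was shown to move the tag with probability exactly `Σ_{j∈js} ptTagCoef_j·r_j`; here the full
one-step DISTRIBUTION of the tag is pinned down (needed to lump the tag to a birth–death walk in
`Scaling/ParallelTemperingHalfSweepWalk`): the tag stays on the pair it sits on, so "moved" means "moved to the
partner level".

## What is proved (`X` measurable; `js` pairwise disjoint)

* `ptPairCycle_tagClosed_pair` — for `j ∈ js` and `tag z ∈ {j, j+1}`: `C_js(z){tag ∉ {j, j+1}} = 0`.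
* **`ptPairCycle_real_tag_succ`** — `C_js(j, x){tag = j+1} = r_j(x)`; **`ptPairCycle_real_tag_pred`** —
  `C_js(j+1, x){tag = j} = r_j(x)` (`j ∈ js`).
* **`ptPairCycle_real_tag_eq_zero`** — if no `j ∈ js` has `σ_j(tag z) = τ' ≠ tag z`, then `C_js(z){tag = τ'} = 0`.

NOT CLAIMED: anything measured.  Literature grade (cell rule): NEW TYPING; nothing cited as a fact; no new bib keys.
-/

noncomputable section

open MeasureTheory ProbabilityTheory Set Filter Finset
open Summit.Ventures.LatticeQCDFlow.Exactness
open scoped ENNReal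

namespace Summit.Ventures.LatticeQCDFlow.Scaling

/-! ## §1 Where the tag goes under a sweep over disjoint pairs -/

section PairCycleTag

variable {Ω : Type*} [MeasurableSpace Ω] {X : Ω → ℝ} {β : ℕ → ℝ} {K : ℕ}

/-- **The tag stays on the pair it sits on**: for `j ∈ js` (pairwise disjoint) and `tag z ∈ {j, j+1}`,
`C_js(z){tag ∉ {j, j+1}} = 0`. [ours] -/
theorem ptPairCycle_tagClosed_pair (hXm : Measurable X) {js : List (Fin K)}
    (hjs : js.Pairwise fun j j' : Fin K => (j : ℕ) + 2 ≤ j' ∨ (j' : ℕ) + 2 ≤ j) {j : Fin K} (hj : j ∈ js)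
    {z : Fin (K + 1) × (Fin (K + 1) → Ω)} (hz : z.1 = Fin.castSucc j ∨ z.1 = Fin.succ j) :
    ptPairCycle hXm β K js z {y | y.1 ∈ ({Fin.castSucc j, Fin.succ j} : Set (Fin (K + 1)))}ᶜ = 0 := by
  refine ptPairCycle_tagClosed hXm (T := ({Fin.castSucc j, Fin.succ j} : Set (Fin (K + 1)))) (fun j' hj' τ hτ => ?_)
    (by rcases hz with h | h <;> simp [h])
  simp only [Set.mem_insert_iff, Set.mem_singleton_iff] at hτ ⊢
  by_cases hjj : j' = j
  · rw [hjj]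
    rcases hτ with rfl | rfl
    · right; exact ptPerm_castSucc j
    · left; exact ptPerm_succ j
  · have hap := forall_apart_of_pairwise hjs j' hj' j hj hjj
    rcases hτ with rfl | rfl
    · left; exact ptPerm_castSucc_of_apart hap
    · right; exact ptPerm_succ_of_apart hap

/-- **If the pair `(τ, τ+1)` is in the list, the sweep sends the tag at `τ` up with probability exactly `r_τ(x)`.**
[ours] -/
theorem ptPairCycle_real_tag_succ (hXm : Measurable X) {js : List (Fin K)}
    (hjs : js.Pairwise fun j j' : Fin K => (j : ℕ) + 2 ≤ j' ∨ (j' : ℕ) + 2 ≤ j) {j : Fin K} (hj : j ∈ js)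
    (x : Fin (K + 1) → Ω) :
    (ptPairCycle hXm β K js (Fin.castSucc j, x)).real {y | ((y.1 : Fin (K + 1)) : ℕ) = (j : ℕ) + 1} =
      ptPairRatio X β K j x := by
  classical
  set z : Fin (K + 1) × (Fin (K + 1) → Ω) := (Fin.castSucc j, x) with hz_def
  -- the move probability is exactly `r_j(x)`: the only pair of `js` carrying the tag `j` is `j` itself
  have hmove : (ptPairCycle hXm β K js z).real {y | ((y.1 : Fin (K + 1)) : ℕ) ≠ ((z.1 : Fin (K + 1)) : ℕ)} =
      ptPairRatio X β K j x := by
    rw [ptPairCycle_real_moves_eq hXm hjs z, ← Finset.add_sum_erase _ _ (List.mem_toFinset.2 hj)]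
    have hrest : ∑ j' ∈ js.toFinset.erase j, ptTagCoef K j' z.1 * ptPairRatio X β K j' z.2 = 0 := by
      refine Finset.sum_eq_zero fun j' hj' => ?_
      have hne : j' ≠ j := Finset.ne_of_mem_erase hj'
      have hap := forall_apart_of_pairwise hjs j' (List.mem_toFinset.1 (Finset.mem_of_mem_erase hj')) j hj hne
      rw [ptTagCoef_eq_ite, hz_def, if_pos (ptPerm_castSucc_of_apart hap), zero_mul]
    rw [hrest, add_zero, hz_def, ptTagCoef_eq_one_of_ne j _ (by rw [ptPerm_castSucc]; exact (ne_of_lt Fin.castSucc_lt_succ).symm),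
      one_mul]
  -- and a moved tag sits at `j+1`
  have hnull := ptPairCycle_tagClosed_pair hXm (β := β) hjs hj (z := z) (Or.inl rfl)
  have hsub1 : {y : Fin (K + 1) × (Fin (K + 1) → Ω) | ((y.1 : Fin (K + 1)) : ℕ) = (j : ℕ) + 1} ⊆
      {y | ((y.1 : Fin (K + 1)) : ℕ) ≠ ((z.1 : Fin (K + 1)) : ℕ)} := by
    intro y hy
    simp only [Set.mem_setOf_eq, hz_def, Fin.val_castSucc] at hy ⊢
    omega
  have hsub2 : {y : Fin (K + 1) × (Fin (K + 1) → Ω) | ((y.1 : Fin (K + 1)) : ℕ) ≠ ((z.1 : Fin (K + 1)) : ℕ)} ⊆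
      {y | ((y.1 : Fin (K + 1)) : ℕ) = (j : ℕ) + 1} ∪
        {y | y.1 ∈ ({Fin.castSucc j, Fin.succ j} : Set (Fin (K + 1)))}ᶜ := by
    intro y hy
    by_cases h : y.1 = Fin.succ j
    · left; simp only [Set.mem_setOf_eq, h, Fin.val_succ]
    · right
      simp only [Set.mem_compl_iff, Set.mem_setOf_eq, Set.mem_insert_iff, Set.mem_singleton_iff, not_or]
      refine ⟨fun h' => hy ?_, h⟩
      rw [h', hz_def]
  refine le_antisymm ?_ ?_
  · rw [← hmove]; exact measureReal_mono hsub1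
  · rw [← hmove]
    calc (ptPairCycle hXm β K js z).real {y | ((y.1 : Fin (K + 1)) : ℕ) ≠ ((z.1 : Fin (K + 1)) : ℕ)}
        ≤ (ptPairCycle hXm β K js z).real ({y | ((y.1 : Fin (K + 1)) : ℕ) = (j : ℕ) + 1} ∪
            {y | y.1 ∈ ({Fin.castSucc j, Fin.succ j} : Set (Fin (K + 1)))}ᶜ) := measureReal_mono hsub2
      _ ≤ (ptPairCycle hXm β K js z).real {y | ((y.1 : Fin (K + 1)) : ℕ) = (j : ℕ) + 1} +
            (ptPairCycle hXm β K js z).real {y | y.1 ∈ ({Fin.castSucc j, Fin.succ j} : Set (Fin (K + 1)))}ᶜ :=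
          measureReal_union_le _ _
      _ = (ptPairCycle hXm β K js z).real {y | ((y.1 : Fin (K + 1)) : ℕ) = (j : ℕ) + 1} := by
          have h0 : (ptPairCycle hXm β K js z).real
              {y | y.1 ∈ ({Fin.castSucc j, Fin.succ j} : Set (Fin (K + 1)))}ᶜ = 0 := by
            rw [measureReal_def, hnull, ENNReal.toReal_zero]
          rw [h0, add_zero]

/-- **…and down with probability exactly `r_j(x)` from `j+1`.** [ours] -/
theorem ptPairCycle_real_tag_pred (hXm : Measurable X) {js : List (Fin K)}
    (hjs : js.Pairwise fun j j' : Fin K => (j : ℕ) + 2 ≤ j' ∨ (j' : ℕ) + 2 ≤ j) {j : Fin K} (hj : j ∈ js)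
    (x : Fin (K + 1) → Ω) :
    (ptPairCycle hXm β K js (Fin.succ j, x)).real {y | ((y.1 : Fin (K + 1)) : ℕ) = (j : ℕ)} =
      ptPairRatio X β K j x := by
  classical
  set z : Fin (K + 1) × (Fin (K + 1) → Ω) := (Fin.succ j, x) with hz_def
  have hmove : (ptPairCycle hXm β K js z).real {y | ((y.1 : Fin (K + 1)) : ℕ) ≠ ((z.1 : Fin (K + 1)) : ℕ)} =
      ptPairRatio X β K j x := by
    rw [ptPairCycle_real_moves_eq hXm hjs z, ← Finset.add_sum_erase _ _ (List.mem_toFinset.2 hj)]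
    have hrest : ∑ j' ∈ js.toFinset.erase j, ptTagCoef K j' z.1 * ptPairRatio X β K j' z.2 = 0 := by
      refine Finset.sum_eq_zero fun j' hj' => ?_
      have hne : j' ≠ j := Finset.ne_of_mem_erase hj'
      have hap := forall_apart_of_pairwise hjs j' (List.mem_toFinset.1 (Finset.mem_of_mem_erase hj')) j hj hne
      rw [ptTagCoef_eq_ite, hz_def, if_pos (ptPerm_succ_of_apart hap), zero_mul]
    rw [hrest, add_zero, hz_def, ptTagCoef_eq_one_of_ne j _ (by rw [ptPerm_succ]; exact ne_of_lt Fin.castSucc_lt_succ),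
      one_mul]
  have hnull := ptPairCycle_tagClosed_pair hXm (β := β) hjs hj (z := z) (Or.inr rfl)
  have hsub1 : {y : Fin (K + 1) × (Fin (K + 1) → Ω) | ((y.1 : Fin (K + 1)) : ℕ) = (j : ℕ)} ⊆
      {y | ((y.1 : Fin (K + 1)) : ℕ) ≠ ((z.1 : Fin (K + 1)) : ℕ)} := by
    intro y hy
    simp only [Set.mem_setOf_eq, hz_def, Fin.val_succ] at hy ⊢
    omega
  have hsub2 : {y : Fin (K + 1) × (Fin (K + 1) → Ω) | ((y.1 : Fin (K + 1)) : ℕ) ≠ ((z.1 : Fin (K + 1)) : ℕ)} ⊆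
      {y | ((y.1 : Fin (K + 1)) : ℕ) = (j : ℕ)} ∪
        {y | y.1 ∈ ({Fin.castSucc j, Fin.succ j} : Set (Fin (K + 1)))}ᶜ := by
    intro y hy
    by_cases h : y.1 = Fin.castSucc j
    · left; simp only [Set.mem_setOf_eq, h, Fin.val_castSucc]
    · right
      simp only [Set.mem_compl_iff, Set.mem_setOf_eq, Set.mem_insert_iff, Set.mem_singleton_iff, not_or]
      refine ⟨h, fun h' => hy ?_⟩
      rw [h', hz_def]
  refine le_antisymm ?_ ?_
  · rw [← hmove]; exact measureReal_mono hsub1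
  · rw [← hmove]
    calc (ptPairCycle hXm β K js z).real {y | ((y.1 : Fin (K + 1)) : ℕ) ≠ ((z.1 : Fin (K + 1)) : ℕ)}
        ≤ (ptPairCycle hXm β K js z).real ({y | ((y.1 : Fin (K + 1)) : ℕ) = (j : ℕ)} ∪
            {y | y.1 ∈ ({Fin.castSucc j, Fin.succ j} : Set (Fin (K + 1)))}ᶜ) := measureReal_mono hsub2
      _ ≤ (ptPairCycle hXm β K js z).real {y | ((y.1 : Fin (K + 1)) : ℕ) = (j : ℕ)} +
            (ptPairCycle hXm β K js z).real {y | y.1 ∈ ({Fin.castSucc j, Fin.succ j} : Set (Fin (K + 1)))}ᶜ :=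
          measureReal_union_le _ _
      _ = (ptPairCycle hXm β K js z).real {y | ((y.1 : Fin (K + 1)) : ℕ) = (j : ℕ)} := by
          have h0 : (ptPairCycle hXm β K js z).real
              {y | y.1 ∈ ({Fin.castSucc j, Fin.succ j} : Set (Fin (K + 1)))}ᶜ = 0 := by
            rw [measureReal_def, hnull, ENNReal.toReal_zero]
          rw [h0, add_zero]

/-- **If no pair of the list moves the tag to the level `τ'` (no `j ∈ js` with `σ_j τ = τ'`, `τ' ≠ τ`), the sweep
never puts it there.** [ours] -/
theorem ptPairCycle_real_tag_eq_zero (hXm : Measurable X) {js : List (Fin K)}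
    (hjs : js.Pairwise fun j j' : Fin K => (j : ℕ) + 2 ≤ j' ∨ (j' : ℕ) + 2 ≤ j)
    (z : Fin (K + 1) × (Fin (K + 1) → Ω)) {τ' : Fin (K + 1)} (hne : τ' ≠ z.1)
    (hno : ∀ j ∈ js, ptPerm K j z.1 ≠ τ') :
    (ptPairCycle hXm β K js z).real {y | ((y.1 : Fin (K + 1)) : ℕ) = (τ' : ℕ)} = 0 := by
  by_cases hon : ∃ j ∈ js, ptPerm K j z.1 ≠ z.1
  · obtain ⟨j, hj, hmv⟩ := hon
    have hz : z.1 = Fin.castSucc j ∨ z.1 = Fin.succ j := (ptPerm_ne_self_iff j z.1).1 hmv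
    have hnull := ptPairCycle_tagClosed_pair hXm (β := β) hjs hj hz
    have hsub : {y : Fin (K + 1) × (Fin (K + 1) → Ω) | ((y.1 : Fin (K + 1)) : ℕ) = (τ' : ℕ)} ⊆
        {y | y.1 ∈ ({Fin.castSucc j, Fin.succ j} : Set (Fin (K + 1)))}ᶜ := by
      intro y hy
      have hy' : y.1 = τ' := Fin.ext hy
      simp only [Set.mem_compl_iff, Set.mem_setOf_eq, Set.mem_insert_iff, Set.mem_singleton_iff, not_or, hy']
      have h1 := hno j hj
      rcases hz with h | h
      · rw [h, ptPerm_castSucc] at h1; rw [h] at hne; exact ⟨hne, h1.symm⟩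
      · rw [h, ptPerm_succ] at h1; rw [h] at hne; exact ⟨h1.symm, hne⟩
    rw [measureReal_def, measure_mono_null hsub hnull, ENNReal.toReal_zero]
  · push Not at hon
    have hnull := ptPairCycle_tagClosed hXm (β := β) (js := js) (T := ({z.1} : Set (Fin (K + 1))))
      (fun j' hj' τ hτ => by rw [Set.mem_singleton_iff] at hτ; subst hτ; exact hon j' hj') (z := z) rfl
    have hsub : {y : Fin (K + 1) × (Fin (K + 1) → Ω) | ((y.1 : Fin (K + 1)) : ℕ) = (τ' : ℕ)} ⊆
        {y | y.1 ∈ ({z.1} : Set (Fin (K + 1)))}ᶜ := by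
      intro y hy
      have hy' : y.1 = τ' := Fin.ext hy
      simp only [Set.mem_compl_iff, Set.mem_setOf_eq, Set.mem_singleton_iff, hy']
      exact hne
    rw [measureReal_def, measure_mono_null hsub hnull, ENNReal.toReal_zero]

end PairCycleTag

end Summit.Ventures.LatticeQCDFlow.Scaling

end
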